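import Summits.BirchSwinnertonDyer.BirchSwinnertonDyer.Theses.KatoDescentPotSupersingular
import Summits.BirchSwinnertonDyer.BirchSwinnertonDyer.Theorems.KatoDescentKMCImpReading
import Summits.BirchSwinnertonDyer.Rank1Residual.O6.X3WildOfKMCTorsionFreeMember
import Summits.BirchSwinnertonDyer.Rank1Residual.Additive.N10IsogenyTransport
import Summits.BirchSwinnertonDyer.Rank1Residual.Additive.PotSupersingularClasses
import Summits.BirchSwinnertonDyer.Rank1Residual.Additive.KatoDescentClosedBindersContraBridge
import HarnessLib

/-!
# Route K9 `KatoDescentPotSupersingular` — glue `WildRankOneOfKMCFineContraPR` of the 19200 family (gen 2, print-exact KMC node), PROVED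

Cell bsd-potss, plan g28 (CONVENTION Q re-key). The glue item `WildRankOneOfKMCFineContraPR` of route `KatoDescentPotSupersingular` PROVED, type = the route
decl verbatim: the print-exact KMC node(s) at bsd-cm's contragredient closed pair
(`IsKatoZetaDescentDatumOfContra`, `KatoMainConjectureFineContra`, p628155) → HELD print readings → published facts →
parent. Kernel: the generic `…_of_kmcImp…` descents of `KatoDescentKMCImpReading` with the interface lemma
`conj1210_of_isKatoZetaDescentDatumOfContra_of_katoMainConjectureFineContra` (in the `hread` binder shape: bsd-cm's landed
`ContraBridge.conj1210_of_isOfContra_of_kmcFineContra`, p629405); a torsion-free member by Mazur–Kenku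
(`Addv.exists_torsionFree_member`); Cassels/GZK/modularity transport back to the row. Conditional content: none
beyond the displayed route items (two conjecture-grade nodes + held print inputs); nothing is credited toward BSD.
[cite: Kato2004Asterisque, Conj. 12.10 (p. 224), §14.14 (p. 243), Prop. 14.16 (p. 244)]
[cite: BurnsKuriharaSano2019, Thm. 7.6 (p. 29)] [cite: Cassels1965ArithmeticVIII] [cite: Mazur1978, Thm. 1]
-/

set_option linter.dupNamespace false

noncomputable section

open scoped Classical

namespace Summit.BirchSwinnertonDyer.BirchSwinnertonDyer.Theorems

open WeierstrassCurve Literature.NumberTheory.EllipticCurves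
  Literature.NumberTheory.EllipticCurves.Rank1Residual
  Literature.NumberTheory.EllipticCurves.Rank1Residual.Typed
  Summit.BirchSwinnertonDyer.Rank1Residual.Additive
  Summit.BirchSwinnertonDyer.Rank1Residual
  Summit.BirchSwinnertonDyer.BirchSwinnertonDyer.Theses.KatoDescentPotSupersingular



/-- **The gen-2 glue of the rank-one residual CLOSED**: `WildRankOneOfKMCFineContraPR` (children ⟹ `WildRankOne`). -/
theorem wildRankOne_of_kmcFineContraPR :
    Summit.BirchSwinnertonDyer.BirchSwinnertonDyer.Theses.KatoDescentPotSupersingular.WildRankOneOfKMCFineContraPR := by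
  rintro hKMC hPR ⟨hC, hreal⟩ ⟨hCassels, hGZK, hmod, hMK⟩ W _ _ _ hr hO
  haveI : Finite W.sha := (hGZK W (by rw [hr])).2
  refine missingPPartAt_of_bsdp W 3 ?_
  obtain ⟨W', hW', hM', hiso, hadd', hj', ht'⟩ :=
    Addv.exists_torsionFree_member hMK hO.1 hO.2.1 hO.padicValRat_j_nonneg
  haveI := hW'
  haveI := hM'
  have hr' : W'.analyticRank = 1 := by rw [← analyticRank_eq_of_isIsogenous' hiso, hr]
  have hwit : ∃ (W₀ : WeierstrassCurve ℚ) (_ : W₀.IsElliptic) (_ : W₀.IsGloballyMinimal),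
      ClassO6 W₀ 3 ∧ WeierstrassCurve.IsIsogenous W₀ W' := ⟨W, inferInstance, inferInstance, hO, hiso⟩
  have hkmc' : KatoMainConjectureFineContra W' 3 := hKMC W' hr' hadd' hj' ht' hwit
  have hPR' : PerrinRiouUpToUnitAt Kato2004.PRRatio W' 3 := hPR W' hr' hadd' hj' ht' hwit
  have hbsd' : BSDp W' 3 :=
    KatoDescentKMCImpReading.rankOne_bsdp_of_kmcImp_of_perrinRiou W' 3 hC hreal ContraBridge.conj1210_of_isOfContra_of_kmcFineContra hGZK hmod hr'
      hO.1 hadd' hj' ht' hPR' hkmc'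
  exact N10.bsdp_of_isIsogenous_of_bsdp 3 hCassels hGZK hmod hiso (by rw [hr]) hbsd'


end Summit.BirchSwinnertonDyer.BirchSwinnertonDyer.Theorems

end
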